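import Summits.BirchSwinnertonDyer.BirchSwinnertonDyer.Theorems.PrintCFramBottomClassIndexLawFiveLeFlipRungTwoOfJML
import Summits.BirchSwinnertonDyer.BirchSwinnertonDyer.Theorems.PrintCFramBottomClassIndexLawFiveLeFlipRungTwoOfRungTwo
import HarnessLib

/-!
# Crux `PrintCFram.BottomClassIndexLawFiveLe` (stmt-BirchSwinnertonDyer-20372), line `eisenstein-resource-bdp-line` (registry v29,
# `stub_flipRungs.2` = (FlipRungTwo⁶)): T6 piece P5, glue — (FlipRungTwo⁶) ⟸ (JMLTwo⁶) ∧ (RungTwo⁶)∣_{8 ∣ m}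
# (cell `bsd-print-cfram`, width seat `bsd-line-cfram-p1-w6` g10; THEOREMS ONLY, `--supports` 20372; BSD is not proved by any of this)

HONEST FRAMING. Nothing here is a statement about BSD; no registered stub is closed. One composition for LEAD's v30 `_of`:
w7 g8's layer A `flipRungTwo_six_of_rungTwo` (p711746: (RungTwo⁶) → (FlipRungTwo⁶)) ∘ this seat's `rungTwo_six_of_four_of_eight` ∘
`rungTwoFour_six_of_jmlTwo` (`…FlipRungTwoOfJML`: (JMLTwo⁶) → (RungTwo⁶)∣_{¬ 8 ∣ m}), i.e.
**`flipRungTwo_six_of_jmlTwo_of_eight : (JMLTwo⁶) → (RungTwo⁶)∣_{8 ∣ m} → (FlipRungTwo⁶)`** with (FlipRungTwo⁶) = v29 `stub_flipRungs.2`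
= the `hFlipTwo` binder of `FlipRung.seedOffExc_of_flipRung_of_flipRungTwo_of_badOdd_cut` VERBATIM: the slot is fed by T6e's proof of
(JMLTwo⁶) (the `4 ∥ m` modular side: w7 g8 P1–P4 + Katz) and ONE residual stub, the `8 ∣ m` half of (RungTwo⁶) (piece P6, `U_2` not in the
tree). No definitions, no named facts, no `sorry`. beyond-print theorem: NO (composition).
References: crux notes `Lines/eisenstein-resource-bdp-line-w7g8-T6.md` §2, §5c–5d; [Cohen1975] Thm. 3.1; [Washington1997] Thm. 4.2.
-/

set_option autoImplicit false
-- summit-side namespace `Summit.BirchSwinnertonDyer.BirchSwinnertonDyer.…` (single-conjunct summit, D-0017 layout)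
set_option linter.dupNamespace false

noncomputable section

open scoped Classical NumberTheorySymbols
open NumberField DirichletCharacter Literature.NumberTheory.LFunctions
  Literature.NumberTheory.ModularForms.CohenEisenstein
  Literature.NumberTheory.EllipticCurves Literature.NumberTheory.EllipticCurves.KrizLi2019
  Literature.NumberTheory.QuadraticFields

namespace Summit.BirchSwinnertonDyer.BirchSwinnertonDyer.Theorems.PrintCFram.FlipRung

/-! ## (FlipRungTwo⁶) ⟸ (JMLTwo⁶) ∧ (RungTwo⁶)∣_{8 ∣ m} -/

/-- **(FlipRungTwo⁶) FROM THE 2-ADIC JOINT MODULAR LEMMA AND THE `8 ∣ m` RESIDUE** — the composition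
`flipRungTwo_six_of_rungTwo ∘ rungTwo_six_of_four_of_eight ∘ rungTwoFour_six_of_jmlTwo` (w7 g8's layer A p711746 on top of `…FlipRungTwoOfJML` §2–§3), so
that registry v30 can feed `stub_flipRungs.2` with T6e's proof of (JMLTwo⁶) and ONE residual stub, the `8 ∣ m` half of (RungTwo⁶) (piece
P6). Conclusion = v29 `stub_flipRungs.2` = the `hFlipTwo` binder of `seedOffExc_of_flipRung_of_flipRungTwo_of_badOdd_cut` VERBATIM.
[cite: Cohen1975, Thm. 3.1] [cite: Washington1997, Thm. 4.2] -/
theorem flipRungTwo_six_of_jmlTwo_of_eight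
    (hJML : ∀ (p : ℕ) [Fact p.Prime] (m : ℕ) [NeZero m] (χ : DirichletCharacter ℚ_[p] m) (k : ℕ),
      (p = 7 ∨ p = 11 ∨ p = 19 ∨ p = 43 ∨ p = 67 ∨ p = 163) →
      m.Coprime p → χ.IsPrimitive → χ.IsQuadratic → (k = (p + 1) / 4 ∨ k = (3 * p - 1) / 4) →
      2 ≤ k → k ≤ p - 2 → χ (-1) * (-1) ^ k = -1 → 2 ∣ m → 4 ∣ m → ¬ 8 ∣ m →
      ∀ (τ : ℕ → ℤ), (∀ q' : ℕ, q'.Prime → q' ∣ m → q' ≠ 2 → (τ q' = 1 ∨ τ q' = -1)) →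
      ∀ (a : ℕ → ℚ),
        (∀ i : ℕ, (m / 4 ∣ i ∧
            (∀ q' : ℕ, q'.Prime → q' ∣ m → q' ≠ 2 → jacobiSym (-((i / (m / 4) : ℕ) : ℤ)) q' = τ q') ∧
            ¬ 3 ∣ i / (m / 4)) → a i = cohenH k i) →
        (∀ i : ℕ, ¬ (m / 4 ∣ i ∧
            (∀ q' : ℕ, q'.Prime → q' ∣ m → q' ≠ 2 → jacobiSym (-((i / (m / 4) : ℕ) : ℤ)) q' = τ q') ∧
            ¬ 3 ∣ i / (m / 4)) → a i = 0) →
      ∃ N : ℕ, ¬ p ∣ N ∧ 2 ∣ N ∧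
        ∀ c : ℕ,
          (∀ n : ℕ, n % 8 = c % 8 →
            ∃ y : ℂ, (∃ j : ℕ, IsIntegral ℤ ((N : ℂ) ^ j * y)) ∧ ((a (4 * n) : ℚ) : ℂ) = (p : ℂ) * y) →
          ∀ n : ℕ, (n + c) % 4 = (2 * k + 1) % 4 → ¬ 4 ∣ n →
            ∃ y : ℂ, (∃ j : ℕ, IsIntegral ℤ ((N : ℂ) ^ j * y)) ∧ ((a (4 * n) : ℚ) : ℂ) = (p : ℂ) * y)
    (hEight : ∀ (p : ℕ) [Fact p.Prime] (m : ℕ) [NeZero m] (χ : DirichletCharacter ℚ_[p] m) (k : ℕ),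
      (p = 7 ∨ p = 11 ∨ p = 19 ∨ p = 43 ∨ p = 67 ∨ p = 163) →
      m.Coprime p → χ.IsPrimitive → χ.IsQuadratic → (k = (p + 1) / 4 ∨ k = (3 * p - 1) / 4) →
      2 ≤ k → k ≤ p - 2 → χ (-1) * (-1) ^ k = -1 → 2 ∣ m → 8 ∣ m →
      ∀ (τ : ℕ → ℤ), (∀ q' : ℕ, q'.Prime → q' ∣ m → q' ≠ 2 → (τ q' = 1 ∨ τ q' = -1)) →
      (∀ a : ℕ, m ∣ a → a / m % 4 = 3 →
        (∀ q' : ℕ, q'.Prime → q' ∣ m → q' ≠ 2 → jacobiSym (-((a / m : ℕ) : ℤ)) q' = τ q') →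
        a / m % 8 = 7 → ¬ 3 ∣ a / m → ‖((cohenH k a : ℚ) : ℚ_[p])‖ ≤ (p : ℝ)⁻¹) →
      ∀ a : ℕ, m ∣ a → a / m % 4 = 3 →
        (∀ q' : ℕ, q'.Prime → q' ∣ m → q' ≠ 2 → jacobiSym (-((a / m : ℕ) : ℤ)) q' = τ q') →
        a / m % 8 = 3 → ¬ 3 ∣ a / m → ‖((cohenH k a : ℚ) : ℚ_[p])‖ ≤ (p : ℝ)⁻¹) :
    ∀ (p : ℕ) [Fact p.Prime] (m : ℕ) [NeZero m] (χ : DirichletCharacter ℚ_[p] m) (k : ℕ),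
      (p = 7 ∨ p = 11 ∨ p = 19 ∨ p = 43 ∨ p = 67 ∨ p = 163) →
      m.Coprime p → χ.IsPrimitive → χ.IsQuadratic → (k = (p + 1) / 4 ∨ k = (3 * p - 1) / 4) →
      2 ≤ k → k ≤ p - 2 → χ (-1) * (-1) ^ k = -1 → 2 ∣ m →
      ∀ (τ : ℕ → ℤ), (∀ q' : ℕ, q'.Prime → q' ∣ m → q' ≠ 2 → (τ q' = 1 ∨ τ q' = -1)) →
      (∀ (K₀ : Type) [Field K₀] [NumberField K₀] (ε₀ : DirichletCharacter ℚ_[p] (NumberField.discr K₀).natAbs),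
        IsImaginaryQuadratic K₀ → Odd (NumberField.discr K₀) → NumberField.discr K₀ < -4 →
        ¬ ((3 : ℤ) ∣ NumberField.discr K₀) →
        (∀ q' : ℕ, q'.Prime → q' ∣ m → q' ≠ 2 → jacobiSym (NumberField.discr K₀) q' = τ q') →
        NumberField.discr K₀ % 8 = 1 → IsKroneckerCharacterOf K₀ ε₀ →
        ‖(k : ℚ_[p])⁻¹ * @generalizedBernoulli ℚ_[p] _ _
            (changeLevel (dvd_mul_right m (NumberField.discr K₀).natAbs) χ *
              changeLevel (dvd_mul_left (NumberField.discr K₀).natAbs m) ε₀).conductor ⟨conductor_ne_zero _⟩ k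
            (changeLevel (dvd_mul_right m (NumberField.discr K₀).natAbs) χ *
              changeLevel (dvd_mul_left (NumberField.discr K₀).natAbs m) ε₀).primitiveCharacter‖ ≤ (p : ℝ)⁻¹) →
      ∀ (K₀ : Type) [Field K₀] [NumberField K₀] (ε₀ : DirichletCharacter ℚ_[p] (NumberField.discr K₀).natAbs),
        IsImaginaryQuadratic K₀ → Odd (NumberField.discr K₀) → NumberField.discr K₀ < -4 →
        ¬ ((3 : ℤ) ∣ NumberField.discr K₀) →
        (∀ q' : ℕ, q'.Prime → q' ∣ m → q' ≠ 2 → jacobiSym (NumberField.discr K₀) q' = τ q') →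
        NumberField.discr K₀ % 8 = 5 → IsKroneckerCharacterOf K₀ ε₀ →
        ‖(k : ℚ_[p])⁻¹ * @generalizedBernoulli ℚ_[p] _ _
            (changeLevel (dvd_mul_right m (NumberField.discr K₀).natAbs) χ *
              changeLevel (dvd_mul_left (NumberField.discr K₀).natAbs m) ε₀).conductor ⟨conductor_ne_zero _⟩ k
            (changeLevel (dvd_mul_right m (NumberField.discr K₀).natAbs) χ *
              changeLevel (dvd_mul_left (NumberField.discr K₀).natAbs m) ε₀).primitiveCharacter‖ ≤ (p : ℝ)⁻¹ :=
  flipRungTwo_six_of_rungTwo (rungTwo_six_of_four_of_eight (rungTwoFour_six_of_jmlTwo hJML) hEight)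

end Summit.BirchSwinnertonDyer.BirchSwinnertonDyer.Theorems.PrintCFram.FlipRung

end
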